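import Literature.Probability.Percolation.KozmaNitzanGoodQuadruple
import Summits.CriticalPhenomena.PercolationContinuityZ3.Theorems.PercNearOneGluingNoHeavyLowerTailMixCSHTheoremOne
import HarnessLib

/-!
# `NoHeavyLowerTail` (stmt-CriticalPhenomena-4575) — goodness from a POCKET-STABLE loneliest relay
# (Kozma–Nitzan goodness for an ARBITRARY observer side, criterion K0)

Support file (`--supports stmt-CriticalPhenomena-4575`, hull-port prover `prim-hp-2`, gen 14).  No definitions, no named
facts, no sorries.

Kozma–Nitzan (arXiv:2401.12397, §3.2 p. 12) call a quadruple `(G, A, 0, b)` GOOD if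
`P(0 ↔ b) ≥ min_a P(a ↔ b) − Σ_{W ∩ A = ∅} P(C(0) = W) · min_a P_{G∖W}(a ↔ b)` (tree: `KNGood`), and prove goodness for
one-layer observers (Theorem 4) and chains (Theorem 5).  The correction term takes, in EVERY pocket `W` of the observer,
the loneliest relay OF THAT POCKET'S residual graph `G ∖ W`; this is what makes goodness strictly stronger than the
pre-FKG inequality (41) of Questions 7–9 and what a level-by-level induction cannot control in general ("the relay order
flips between pockets", memo run/shared/lean/prim/prim-hp-2/MEMO-gen10 §2).  This file isolates the complementary regime:

* `KNGoodPocketStable.designated_of_pocketStableWitness` — **criterion K0, designated form.**  Let `o ∉ A`, `c ∈ A`, and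
  suppose `c` minimises `P_{G∖{0}}(· ↔ b)` over `A` (the graph with the observer's pairs removed) and minimises
  `P_{G∖W}(· ↔ b)` over `A` for every `W ∩ A = ∅` with `P(C(0) = W) > 0`.  Then
  `P(c ↔ b) − Σ_{W ∩ A = ∅} P(C(0) = W) · min_a P_{G∖W}(a ↔ b) ≤ P(0 ↔ b)`.
  Proof: by pocket stability the correction term is `Σ_W P(C(0) = W) P_{G∖W}(c ↔ b) = P(c ↔ b, 0 ↮ A)` (spatial Markov
  property `KNGoodAux.real_clusterIs_inter_openConn` summed by `KNGoodAux.sum_real_clusterIs_inter`), so the claim is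
  `P(c ↔ b, 0 ↔ A) ≤ P(0 ↔ b)`, i.e. Kozma–Nitzan's Question 9 at the designated `G ∖ {0}`-minimiser `c`, in the tree for
  every relay set and every weight function (`MixCSH.kn_question9`).
* `KNGoodPocketStable.knGood_of_pocketStableWitness` — hence **`(G, A, 0, b)` is good**, for an arbitrary observer side
  (any depth, any pocket structure, any `|A|`).
* `KNGoodPocketStable.knGood_of_pocketStableWitness'` — the same with the stability hypothesis for ALL `W ∋ 0` with
  `W ∩ A = ∅` (no positivity side condition).

For `|A| = 2` pocket stability is automatic for separated quadruples (two-point amalgamation, `KNGoodTwoRelays.two_sep_le`,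
`openConnIn_le_of_T_le`), which is how `KNGoodTwoRelays.knGood_two_relays` (p209971) was proved; Theorem 4 is the case in
which `{0}` is the only pocket.  Numerically K0 holds in ≈ 80 % of random separated quadruples with `|A| = 3` and ≈ 67 %
with `|A| = 4` (memo MEMO-gen12 §4); the remaining instances are the genuine cross-pocket transfer problem (Conjecture UG).
Dependence: `MixCSH.kn_question9` (p205010 lineage, CSH).
[cite: KozmaNitzan2024, §3.2 Definition and Thms. 4–5 (pp. 12–14), Question 9 (§5.5 p. 36)]
-/

noncomputable section

namespace Summit.CriticalPhenomena.PercolationContinuityZ3.Theorems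

open MeasureTheory Set Literature.Probability.LatticeModels Literature.Probability.Percolation
open scoped Classical

namespace KNGoodPocketStable

open KNGoodAux

variable {V : Type*} [Fintype V]

/-- **Criterion K0, designated form.**  `o ∉ A`, `c ∈ A`; `c` minimises `P_{G∖{0}}(· ↔ b)` over `A`, and minimises
`P_{G∖W}(· ↔ b)` over `A` for every `W` with `W ∩ A = ∅` and `P(C(0) = W) ≠ 0`.  Then
`P(c ↔ b) − Σ_{W ∩ A = ∅} P(C(0) = W) · min_a P_{G∖W}(a ↔ b) ≤ P(0 ↔ b)`.
(Correction term `= P(c ↔ b, 0 ↮ A)` by pocket stability and the spatial Markov property; then Question 9 at `c`.)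
[cite: KozmaNitzan2024, §3.2 Definition (p. 12), Question 9 (§5.5 p. 36)] -/
theorem designated_of_pocketStableWitness [DecidableEq V] (w : Sym2 V → unitInterval) (A : Finset V)
    (hA : A.Nonempty) (o b c : V) (hoA : o ∉ A) (hcA : c ∈ A)
    (hc0 : ∀ a ∈ A, (prodBernoulli w).real (openConnIn ({o}ᶜ : Set V) c b) ≤
      (prodBernoulli w).real (openConnIn ({o}ᶜ : Set V) a b))
    (hcW : ∀ W ∈ nullSets A, (prodBernoulli w).real (clusterIs o W) ≠ 0 → ∀ a ∈ A,
      (prodBernoulli w).real (openConnIn ((↑W : Set V)ᶜ) c b) ≤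
        (prodBernoulli w).real (openConnIn ((↑W : Set V)ᶜ) a b)) :
    (prodBernoulli w).real (openConn c b) -
        ∑ W ∈ nullSets A, (prodBernoulli w).real (clusterIs o W) *
          A.inf' hA (fun a => (prodBernoulli w).real (openConnIn ((↑W : Set V)ᶜ) a b)) ≤
      (prodBernoulli w).real (openConn o b) := by
  set μ := prodBernoulli w with hμ
  have hmeas : ∀ S : Set (BondConfig V), MeasurableSet S := fun _ => MeasurableSet.of_discrete
  have hco : c ≠ o := fun h => hoA (h ▸ hcA)
  -- Question 9 at the designated `G ∖ {0}`-minimiser `c`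
  set U : Set (BondConfig V) := ⋃ a' ∈ A, openConn o a' with hU
  have hmin9 : ∀ a ∈ A, (prodBernoulli (restrW ({o}ᶜ : Set V) w)).real (openConn c b) ≤
      (prodBernoulli (restrW ({o}ᶜ : Set V) w)).real (openConn a b) := by
    intro a ha
    have hao : a ≠ o := fun h => hoA (h ▸ ha)
    rw [restrW_real_openConn w o hco b, restrW_real_openConn w o hao b]
    exact hc0 a ha
  have hq9 : μ.real (openConn c b ∩ U) ≤ μ.real (openConn o b ∩ U) :=
    MixCSH.kn_question9 w o A hoA b c hcA hmin9
  have hq9' : μ.real (openConn o b ∩ U) ≤ μ.real (openConn o b) :=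
    measureReal_mono inter_subset_left
  -- the correction term equals `P(c ↔ b, 0 ↮ A)`
  have hsplit : μ.real (openConn c b ∩ U) + μ.real (openConn c b \ U) = μ.real (openConn c b) :=
    measureReal_inter_add_sdiff (hmeas U)
  have hdiff : (openConn c b : Set (BondConfig V)) \ U =
      {ω : BondConfig V | ∀ a ∈ A, ¬ (openGraph ω).Reachable o a} ∩ openConn c b := by
    ext ω
    simp only [hU, mem_sdiff, mem_iUnion, mem_inter_iff, mem_setOf_eq, exists_prop, not_exists, not_and]
    constructor
    · rintro ⟨h1, h2⟩; exact ⟨fun a ha => h2 a ha, h1⟩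
    · rintro ⟨h2, h1⟩; exact ⟨h1, fun a ha => h2 a ha⟩
  have hsum := sum_real_clusterIs_inter w A o (openConn c b : Set (BondConfig V))
  rw [← hdiff] at hsum
  have hterm : ∀ W ∈ nullSets A, μ.real (clusterIs o W ∩ openConn c b) =
      μ.real (clusterIs o W) * A.inf' hA (fun a => μ.real (openConnIn ((↑W : Set V)ᶜ) a b)) := by
    intro W hWn
    have hWA : Disjoint W A := mem_nullSets.1 hWn
    have hcW' : c ∉ W := fun h => Finset.disjoint_left.1 hWA h hcA
    rw [real_clusterIs_inter_openConn w o W hcW' b]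
    by_cases hz : μ.real (clusterIs o W) = 0
    · rw [hz, zero_mul, zero_mul]
    · congr 1
      exact le_antisymm ((Finset.le_inf'_iff hA _).2 (hcW W hWn hz)) (Finset.inf'_le _ hcA)
  have hD : ∑ W ∈ nullSets A, μ.real (clusterIs o W) *
        A.inf' hA (fun a => μ.real (openConnIn ((↑W : Set V)ᶜ) a b)) = μ.real (openConn c b \ U) := by
    rw [← hsum]
    exact (Finset.sum_congr rfl hterm).symm
  rw [hD]
  linarith

/-- **Criterion K0: a pocket-stable loneliest relay makes the quadruple good** (arbitrary observer side).  `o ∉ A`,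
`c ∈ A`; `c` minimises `P_{G∖{0}}(· ↔ b)` over `A` and `P_{G∖W}(· ↔ b)` over `A` for every `W ∩ A = ∅` with
`P(C(0) = W) ≠ 0`.  Then `KNGood w A hA o b`. [cite: KozmaNitzan2024, §3.2 Definition (p. 12), Question 9 (§5.5 p. 36)] -/
theorem knGood_of_pocketStableWitness [DecidableEq V] (w : Sym2 V → unitInterval) (A : Finset V)
    (hA : A.Nonempty) (o b c : V) (hoA : o ∉ A) (hcA : c ∈ A)
    (hc0 : ∀ a ∈ A, (prodBernoulli w).real (openConnIn ({o}ᶜ : Set V) c b) ≤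
      (prodBernoulli w).real (openConnIn ({o}ᶜ : Set V) a b))
    (hcW : ∀ W ∈ nullSets A, (prodBernoulli w).real (clusterIs o W) ≠ 0 → ∀ a ∈ A,
      (prodBernoulli w).real (openConnIn ((↑W : Set V)ᶜ) c b) ≤
        (prodBernoulli w).real (openConnIn ((↑W : Set V)ᶜ) a b)) :
    KNGood w A hA o b := by
  have h := designated_of_pocketStableWitness w A hA o b c hoA hcA hc0 hcW
  have hinf : A.inf' hA (fun a => (prodBernoulli w).real (openConn a b)) ≤
      (prodBernoulli w).real (openConn c b) := Finset.inf'_le _ hcA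
  unfold KNGood
  linarith

/-- Criterion K0 with the stability hypothesis stated for every `W ∋ 0` with `W ∩ A = ∅` (this includes `W = {0}`, which
is the `G ∖ {0}` condition). [cite: KozmaNitzan2024, §3.2 Definition (p. 12), Question 9 (§5.5 p. 36)] -/
theorem knGood_of_pocketStableWitness' [DecidableEq V] (w : Sym2 V → unitInterval) (A : Finset V)
    (hA : A.Nonempty) (o b c : V) (hoA : o ∉ A) (hcA : c ∈ A)
    (hcW : ∀ W : Finset V, o ∈ W → Disjoint W A → ∀ a ∈ A,
      (prodBernoulli w).real (openConnIn ((↑W : Set V)ᶜ) c b) ≤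
        (prodBernoulli w).real (openConnIn ((↑W : Set V)ᶜ) a b)) :
    KNGood w A hA o b := by
  refine knGood_of_pocketStableWitness w A hA o b c hoA hcA ?_ ?_
  · intro a ha
    have h := hcW {o} (Finset.mem_singleton_self o) (Finset.disjoint_singleton_left.2 hoA) a ha
    simpa only [Finset.coe_singleton] using h
  · intro W hWn hz a ha
    refine hcW W ?_ (mem_nullSets.1 hWn) a ha
    by_contra hoW
    apply hz
    have : (clusterIs o W : Set (BondConfig V)) = ∅ := by
      ext ω
      simp only [mem_empty_iff_false, iff_false]
      intro hω
      rw [mem_clusterIs] at hω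
      have : o ∈ (↑W : Set V) := by rw [← hω]; exact mem_openCluster_self ω o
      exact hoW (Finset.mem_coe.1 this)
    rw [this, measureReal_empty]

end KNGoodPocketStable

end Summit.CriticalPhenomena.PercolationContinuityZ3.Theorems
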